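import Summits.QuantumFields.YangMills.Theorems.BalabanUVNodesN15CovariantLandauTwoGridStairLetter
import Summits.QuantumFields.YangMills.Theorems.BalabanUVNodesN15CovariantAveragingHolonomyLineFit
import Summits.QuantumFields.YangMills.Theorems.BalabanUVNodesN15CovariantLandauMass
import Summits.QuantumFields.YangMills.Theorems.BalabanUVNodesN15GenuineUnitKernelRate
import HarnessLib

/-!
# Route «BalabanUVNodes», node N15 = NE2, road (c) — PROGRAMME (P-S), XLII: THE TWO-GRID STAIRCASE FIT `φ` OF n15-c∕245 FROM (3.35) — the column fit of the knit's block-base transports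
# `U′(B′x′, a′x′) − U(B(pr x′), a(pr x′))` by n15-c∕185b's staircase holonomy fit, and n15-c∕243's block-diagonal letter row `hDQt` AS A THEOREM (dag-n15-c g25, n15-c∕249)

Cell `pub-ymgap`, seat `pub-ymgap-dag-n15-c` (generation g25; R134 (a), s1; HUMAN RULING D-0062; chair R424 venue).  `bears_on: R4∕N15 · K3⁸ SpineGivenEndpointR13SepCoPHV
(stmt-QuantumFields-27366)`; filed `--supports stmt-QuantumFields-27366 --as helper` — COUNT-NEUTRAL.  Theorems only; 0 `sorry`.  Imports BY NAME n15-c∕245 (`hasMaj_idef_nu_csavg_transpose`), n15-c∕185b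
(`norm_holStair_two_grid_le`, `cvaStair_conj`, `holStair_unitary`, `kingPr_bpt_hdig`, `blockOf_kingPr`), `CurvedSpecies.uN_abs_coordMat_conj_sub_conj_entry_le_op`, `exp_smul_unitary_of_conjTranspose`,
`gavgM_conjTranspose_of_skew`.  Nothing in the tree is modified.

WHY.  n15-c∕243 `hasMaj_idef_cvNVr_of_rows` displays `hDQt`, the block-diagonal row of the two-grid letter `idef (ν•id) P̂_S (Q′_{T′}ᵀ) (Q_Tᵀ)`; n15-c∕245 reduced it to the COLUMN FIT `φ` of the
block-base staircase transports `cvaStair_{n′}(T′)(B′x′, a′x′) − cvaStair_n(T)(B(pr x′), a(pr x′))`.  For the knit's data `T′ = cvT₀ e e^{A′/n′}`, `T = cvT₀ e e^{Ā/n}` (`Ā = gavgM π̂ A′`) these are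
the coordinate matrices of `Ad` of the staircase HOLONOMIES (n15-c∕185a `cvaStair_conj`), King's pairing sends `(B′x′, a′x′)` to `(B′x′, hdig a′x′)` (`kingPr_bpt_hdig`), and n15-c∕185b
`norm_holStair_two_grid_le` bounds the holonomy difference by `3^{d+1}((d+1)·36·2(d+1)(L^m−1)·r/n′ + 9L^m·r/n′) = O((d+1)²·r/n)` from (3.35)'s first two members (`‖A′‖ ≤ r`, unit steps `≤ r/n′`).
* `gavgM_kingPrV_slice` (the block mean of the own-component slice is the slice of the block mean), `blockOf_eq_blockCoords_fst`, `cvaStair_cvT₀_eq_conj`;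
* ★★ `stairFit_cols_le` — 245's `hfit` AS A THEOREM: `φ = |ι|·κ_e·2√m·√m·3^{d+1}(…)`;
* ★★★ `hasMaj_idef_nu_csavg_transpose_exp` — 243's `hDQt` for the knit's transporters from (3.35) alone.

HONEST FRAMING ∕ LIMITS.  Bookkeeping over n15-c∕185b∕245; MODEL transporters (site data, King's pairing on the doubled tori); NOT [Balaban1985BackgroundPropagators] (3.19) ∕ Lemma 3.3 ∕ Thm 3.14
as printed; NE2⁺ NOT PRINTED; N15 of record untouched (DISCHARGED AS CONSUMED, p687738); counts UNMOVED (typed 28∕28 · discharged 8∕27); one finite 𝕋⁴ at fixed ε per index — NOT infinite volume ∕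
OS ∕ mass gap ∕ Clay.  Restate-immune (no Theses import).
-/

noncomputable section

open scoped BigOperators Matrix
open Finset

namespace Summit.QuantumFields.YangMills.BalabanUVNodes.N15.Gluing

open Literature.MathematicalPhysics.QuantumFieldTheory.Balaban1983to89
open Literature.MathematicalPhysics.QuantumFieldTheory.Balaban1983to89.B5Prop11Plancherel (Tor fine unitVec)
open Literature.MathematicalPhysics.QuantumFieldTheory.Balaban1983to89.B5Block118 (bpt)
open Literature.MathematicalPhysics.QuantumFieldTheory.Balaban1983to89.B11SectG (BlockNorm HasMaj)
open Literature.MathematicalPhysics.QuantumFieldTheory.Balaban1983to89.B6UnitTorusCarrier (unitTorusGeo)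
open Literature.MathematicalPhysics.QuantumFieldTheory.Balaban1983to89.T4EtaRateDefect (idef)
open Literature.MathematicalPhysics.QuantumFieldTheory.Balaban1983to89.T4EtaRateCoeffDefect (pull fibre mem_fibre)
open Literature.MathematicalPhysics.QuantumFieldTheory.King1986.Torus (blockOf)
open Summit.QuantumFields.YangMills.BalabanUVNodes.N15.MatrixSpecies (liftBlk liftMap coordMat basisConst basisConst_nonneg blockAvgV norm_blockAvgV_le)
open Summit.QuantumFields.YangMills.BalabanUVNodes.N15.BackgroundLayer (gavgM)
open Summit.QuantumFields.YangMills.BalabanUVNodes.N15.CurvedSpecies (exp_smul_unitary_of_conjTranspose uN_abs_coordMat_conj_sub_conj_entry_le_op)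
open Summit.QuantumFields.YangMills.BalabanUVNodes.N15.VectorPiece (kingPr kingPrV kingPrV_eq blockCoords blockCoords_bpt bpt_blockCoords kingPr_bpt_hdig hdig bshiftEquiv)
open Summit.QuantumFields.YangMills.BalabanUVNodes.N15.CovAvg (cvaStair cvaStair_conj holStair holStair_unitary norm_holStair_two_grid_le blockOf_kingPr blockCoords_fst_of_mem_fibre)
open Summit.QuantumFields.YangMills.BalabanUVNodes.N15.CovLandau (csavg hasMaj_idef_nu_csavg_transpose)
open Summit.QuantumFields.YangMills.BalabanUVNodes.N15.GenuineSite (card_fibre_kingPrV)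

variable {d : ℕ} {L : ℕ} [NeZero L]

/-! ## §1 Slices and block coordinates -/

section Slice

variable (M : Fin (d + 1) → ℕ) [∀ μ, NeZero (M μ)] (k m : ℕ) {E : Type} [NormedAddCommGroup E] [NormedSpace ℝ E]

/-- the block mean of the own-component slice `(μ, q) ↦ A′_μ(q.1, μ)` at `b` is the block mean of `A′_μ` at `(b.1, μ)` (the fibres of King's bond pairing differ only by the colour). [cite: King1986, p.664 (pairing convention)] -/
theorem gavgM_kingPrV_slice (A' : Fin (d + 1) → Tor (fine (L ^ m * L ^ k) M) × Fin (d + 1) → E) (μ : Fin (d + 1)) (b : Tor (fine (L ^ k) M) × Fin (d + 1)) :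
    gavgM E (Fin (d + 1)) (kingPrV L k m M) (fun μ' q => A' μ' (q.1, μ')) μ b = gavgM E (Fin (d + 1)) (kingPrV L k m M) A' μ (b.1, μ) := by
  classical
  show blockAvgV (kingPrV L k m M) (fun q => A' μ (q.1, μ)) b = blockAvgV (kingPrV L k m M) (A' μ) (b.1, μ)
  simp only [blockAvgV]
  rw [card_fibre_kingPrV, card_fibre_kingPrV]
  congr 1
  refine Finset.sum_nbij' (fun q => (q.1, μ)) (fun q' => (q'.1, b.2)) (fun q hq => ?_) (fun q' hq' => ?_) (fun q hq => ?_) (fun q' hq' => ?_) (fun q _ => rfl)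
  · have hq' : q ∈ fibre (kingPrV L k m M) b := hq
    rw [mem_fibre, kingPrV_eq, Prod.mk.injEq] at hq'
    show (q.1, μ) ∈ fibre (kingPrV L k m M) (b.1, μ)
    rw [mem_fibre, kingPrV_eq, Prod.mk.injEq]; exact ⟨hq'.1, rfl⟩
  · have hq : q' ∈ fibre (kingPrV L k m M) (b.1, μ) := hq'
    rw [mem_fibre, kingPrV_eq, Prod.mk.injEq] at hq
    show (q'.1, b.2) ∈ fibre (kingPrV L k m M) b
    rw [mem_fibre, kingPrV_eq, Prod.mk.injEq]; exact ⟨hq.1, rfl⟩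
  · have hq' : q ∈ fibre (kingPrV L k m M) b := hq
    rw [mem_fibre, kingPrV_eq, Prod.mk.injEq] at hq'
    exact Prod.ext rfl hq'.2.symm
  · have hq : q' ∈ fibre (kingPrV L k m M) (b.1, μ) := hq'
    rw [mem_fibre, kingPrV_eq, Prod.mk.injEq] at hq
    exact Prod.ext rfl hq.2.symm

omit [NeZero L] in
/-- the block of a fine point is the first block coordinate. [folklore] -/
theorem blockOf_eq_blockCoords_fst (nn : ℕ) [NeZero nn] (x : Tor (fine nn M)) : blockOf nn M x = (blockCoords nn M x).1 := by
  conv_lhs => rw [← bpt_blockCoords nn M x]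
  exact DefectKernel.kingBlockOf_bpt nn M _ _

end Slice

/-! ## §2 The staircase fit and 243's `hDQt` -/

section StairFit

open scoped Matrix.Norms.L2Operator

variable (M : Fin (d + 1) → ℕ) [∀ μ, NeZero (M μ)] (k m : ℕ) {ι : Type} [Fintype ι] [DecidableEq ι]
  {mm : Type} [Fintype mm] [DecidableEq mm] (e : Matrix mm mm ℂ ≃L[ℝ] (ι → ℝ))

/-- the knit's block-base staircase transport is the adjoint action of the staircase holonomy of the own-component slice `(μ, q) ↦ U_μ(q.1, μ)`. [cite: Balaban1985Averaging, (125) p.36 (shape)] -/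
theorem cvaStair_cvT₀_eq_conj (nn : ℕ) [NeZero nn] (U : Fin (d + 1) → Tor (fine nn M) × Fin (d + 1) → Matrix mm mm ℂ) (y : Tor M) (a : Fin (d + 1) → Fin nn) (ν : Fin (d + 1)) :
    cvaStair M nn (fun μ b => cvT₀ e U μ b.1) y a ν =
      coordMat e (ContinuousLinearMap.mulLeftRight ℝ (Matrix mm mm ℂ) (holStair M nn (fun μ q => U μ (q.1, μ)) y a ν) (holStair M nn (fun μ q => U μ (q.1, μ)) y a ν)ᴴ) :=
  cvaStair_conj M nn e (fun μ q => U μ (q.1, μ)) y a ν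

/-- ★★ **THE STAIRCASE FIT (n15-c∕245's `hfit`) FROM (3.35)**: for the fine field `A′` (skew, `‖A′‖ ≤ r ≤ 1`, unit steps `≤ r/n′`) and its King block mean, the column sums of
`cvaStair_{n′}(T′)(B′x′, a′x′) − cvaStair_n(T)(B(pr x′), a(pr x′))` are `≤ |ι|·κ_e·2√m·√m·3^{d+1}((d+1)·36·2(d+1)(L^m−1)·r/n′ + 9L^m·r/n′)`.
[cite: Balaban1985BackgroundPropagators, (3.35) p.396, (3.73) p.405 (two spacings: shape); King1986, p.664 (pairing)] -/
theorem stairFit_cols_le {A' : Fin (d + 1) → Tor (fine (L ^ m * L ^ k) M) × Fin (d + 1) → Matrix mm mm ℂ} (hAs : ∀ μ p, (A' μ p)ᴴ = -A' μ p) {r : ℝ} (hr0 : 0 ≤ r) (hr1 : r ≤ 1)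
    (hA : ∀ μ p, ‖A' μ p‖ ≤ r) (hstep : ∀ μ κ b', ‖A' μ (bshiftEquiv M (L ^ m * L ^ k) κ b') - A' μ b'‖ ≤ r * (((((L ^ m * L ^ k : ℕ) : ℝ)))⁻¹)) (x' : Tor (fine (L ^ m * L ^ k) M)) (i : ι) :
    ∑ j, |((cvaStair M (L ^ m * L ^ k) (fun μ b => cvT₀ e (fun μ p => NormedSpace.exp ((((((L ^ m * L ^ k : ℕ) : ℝ)))⁻¹) • A' μ p)) μ b.1) (blockOf (L ^ m * L ^ k) M x') (blockCoords (L ^ m * L ^ k) M x').2 0) -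
        (cvaStair M (L ^ k) (fun μ b => cvT₀ e (fun μ p => NormedSpace.exp ((((((L ^ k : ℕ) : ℝ)))⁻¹) • gavgM (Matrix mm mm ℂ) (Fin (d + 1)) (kingPrV L k m M) A' μ p)) μ b.1) (blockOf (L ^ k) M (kingPr L k m M x')) (blockCoords (L ^ k) M (kingPr L k m M x')).2 0)) j i| ≤
      Fintype.card ι * (@basisConst ι _ (Matrix mm mm ℂ) Matrix.frobeniusNormedAddCommGroup Matrix.frobeniusNormedSpace e * (2 * Real.sqrt (Fintype.card mm)) * (Real.sqrt (Fintype.card mm) * (3 ^ (d + 1) * ((d + 1) * (36 * (((L ^ m * L ^ k : ℕ) : ℝ)) * (((((L ^ m * L ^ k : ℕ) : ℝ)))⁻¹ * ((2 * ((d + 1) * (L ^ m - 1)) : ℕ) * (r * ((((L ^ m * L ^ k : ℕ) : ℝ)))⁻¹))) + 9 * (((L ^ m : ℕ) : ℝ) * (((((L ^ m * L ^ k : ℕ) : ℝ)))⁻¹ * r))))))) := by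
  have hκ := @basisConst_nonneg ι _ (Matrix mm mm ℂ) Matrix.frobeniusNormedAddCommGroup Matrix.frobeniusNormedSpace e
  -- block coordinates of `x′` and of `pr x′`
  rw [blockOf_kingPr, blockOf_eq_blockCoords_fst M (L ^ m * L ^ k) x']
  have hpr : kingPr L k m M x' = bpt (L ^ k) M (blockCoords (L ^ m * L ^ k) M x').1 (hdig L k m (blockCoords (L ^ m * L ^ k) M x').2) := by
    conv_lhs => rw [← bpt_blockCoords (L ^ m * L ^ k) M x']
    exact kingPr_bpt_hdig L k m M _ _
  have ha : (blockCoords (L ^ k) M (kingPr L k m M x')).2 = hdig L k m (blockCoords (L ^ m * L ^ k) M x').2 := by rw [hpr, blockCoords_bpt]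
  rw [ha, cvaStair_cvT₀_eq_conj, cvaStair_cvT₀_eq_conj]
  -- unitarity of the slices
  have hĀs : ∀ μ p, (gavgM (Matrix mm mm ℂ) (Fin (d + 1)) (kingPrV L k m M) A' μ p)ᴴ = -gavgM (Matrix mm mm ℂ) (Fin (d + 1)) (kingPrV L k m M) A' μ p :=
    fun μ p => gavgM_conjTranspose_of_skew (kingPrV L k m M) hAs μ p
  have hUf : ∀ μ q, ((fun μ (q : Tor (fine (L ^ m * L ^ k) M) × Fin (d + 1)) => (fun μ p => NormedSpace.exp ((((((L ^ m * L ^ k : ℕ) : ℝ)))⁻¹) • A' μ p)) μ (q.1, μ)) μ q)ᴴ * (fun μ (q : Tor (fine (L ^ m * L ^ k) M) × Fin (d + 1)) => (fun μ p => NormedSpace.exp ((((((L ^ m * L ^ k : ℕ) : ℝ)))⁻¹) • A' μ p)) μ (q.1, μ)) μ q = 1 :=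
    fun μ q => exp_smul_unitary_of_conjTranspose (hAs μ (q.1, μ)) _
  have hUc : ∀ μ q, ((fun μ (q : Tor (fine (L ^ k) M) × Fin (d + 1)) => (fun μ p => NormedSpace.exp ((((((L ^ k : ℕ) : ℝ)))⁻¹) • gavgM (Matrix mm mm ℂ) (Fin (d + 1)) (kingPrV L k m M) A' μ p)) μ (q.1, μ)) μ q)ᴴ * (fun μ (q : Tor (fine (L ^ k) M) × Fin (d + 1)) => (fun μ p => NormedSpace.exp ((((((L ^ k : ℕ) : ℝ)))⁻¹) • gavgM (Matrix mm mm ℂ) (Fin (d + 1)) (kingPrV L k m M) A' μ p)) μ (q.1, μ)) μ q = 1 :=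
    fun μ q => exp_smul_unitary_of_conjTranspose (hĀs μ (q.1, μ)) _
  -- the holonomy fit (n15-c∕185b) for the slice field `(μ, q) ↦ A′_μ(q.1, μ)`
  have hAt : ∀ μ (b' : Tor (fine (L ^ m * L ^ k) M) × Fin (d + 1)), ‖(fun μ' (q : Tor (fine (L ^ m * L ^ k) M) × Fin (d + 1)) => A' μ' (q.1, μ')) μ b'‖ ≤ r := fun μ b' => hA μ _
  have hstept : ∀ μ κ (b' : Tor (fine (L ^ m * L ^ k) M) × Fin (d + 1)), ‖(fun μ' (q : Tor (fine (L ^ m * L ^ k) M) × Fin (d + 1)) => A' μ' (q.1, μ')) μ (bshiftEquiv M (L ^ m * L ^ k) κ b') -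
      (fun μ' (q : Tor (fine (L ^ m * L ^ k) M) × Fin (d + 1)) => A' μ' (q.1, μ')) μ b'‖ ≤ r * (((((L ^ m * L ^ k : ℕ) : ℝ)))⁻¹) := fun μ κ b' => hstep μ κ (b'.1, μ)
  have hfit := norm_holStair_two_grid_le M k m hr0 hr1 hAt hstept (blockCoords (L ^ m * L ^ k) M x').1 (blockCoords (L ^ m * L ^ k) M x').2 0
  have hco : (fun μ (b : Tor (fine (L ^ k) M) × Fin (d + 1)) => NormedSpace.exp ((((((L ^ k : ℕ) : ℝ)))⁻¹) • gavgM (Matrix mm mm ℂ) (Fin (d + 1)) (kingPrV L k m M) (fun μ' (q : Tor (fine (L ^ m * L ^ k) M) × Fin (d + 1)) => A' μ' (q.1, μ')) μ b)) =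
      (fun μ (q : Tor (fine (L ^ k) M) × Fin (d + 1)) => (fun μ p => NormedSpace.exp ((((((L ^ k : ℕ) : ℝ)))⁻¹) • gavgM (Matrix mm mm ℂ) (Fin (d + 1)) (kingPrV L k m M) A' μ p)) μ (q.1, μ)) := by
    funext μ b
    simp only [gavgM_kingPrV_slice]
  rw [hco] at hfit
  calc _ ≤ ∑ _j : ι, @basisConst ι _ (Matrix mm mm ℂ) Matrix.frobeniusNormedAddCommGroup Matrix.frobeniusNormedSpace e * (2 * Real.sqrt (Fintype.card mm)) * (Real.sqrt (Fintype.card mm) * (3 ^ (d + 1) * ((d + 1) * (36 * (((L ^ m * L ^ k : ℕ) : ℝ)) * (((((L ^ m * L ^ k : ℕ) : ℝ)))⁻¹ * ((2 * ((d + 1) * (L ^ m - 1)) : ℕ) * (r * ((((L ^ m * L ^ k : ℕ) : ℝ)))⁻¹))) + 9 * (((L ^ m : ℕ) : ℝ) * (((((L ^ m * L ^ k : ℕ) : ℝ)))⁻¹ * r)))))) :=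
        Finset.sum_le_sum fun j _ => (uN_abs_coordMat_conj_sub_conj_entry_le_op e (holStair_unitary M hUc _ _ _) (holStair_unitary M hUf _ _ _) j i).trans (by gcongr)
    _ = _ := by rw [Finset.sum_const, Finset.card_univ, nsmul_eq_mul]

/-- ★★★ **243's `hDQt` FOR THE KNIT's TRANSPORTERS, FROM (3.35)**: the block-diagonal row of `idef (ν•id) P̂_S (Q′_{T′}ᵀ) (Q_Tᵀ)` is `≤ n^{−(d+1)}·φ` on the diagonal, `φ` the staircase fit above.
[cite: Balaban1985BackgroundPropagators, (3.19) p.393, (3.35) p.396, Thm 3.14 pp.426–427 (shapes); King1986, p.664] -/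
theorem hasMaj_idef_nu_csavg_transpose_exp {A' : Fin (d + 1) → Tor (fine (L ^ m * L ^ k) M) × Fin (d + 1) → Matrix mm mm ℂ} (hAs : ∀ μ p, (A' μ p)ᴴ = -A' μ p) {r : ℝ} (hr0 : 0 ≤ r) (hr1 : r ≤ 1)
    (hA : ∀ μ p, ‖A' μ p‖ ≤ r) (hstep : ∀ μ κ b', ‖A' μ (bshiftEquiv M (L ^ m * L ^ k) κ b') - A' μ b'‖ ≤ r * (((((L ^ m * L ^ k : ℕ) : ℝ)))⁻¹)) :
    HasMaj (BlockNorm.ofBlocks (unitTorusGeo L k M) (liftBlk (fun y : Tor M => y) ι)) (BlockNorm.ofBlocks (unitTorusGeo L k M) (liftBlk (blockOf (L ^ m * L ^ k) M) ι))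
      (idef (((((L ^ m) ^ (d + 1) : ℕ) : ℝ)) • (LinearMap.id : (Tor M × ι → ℝ) →ₗ[ℝ] (Tor M × ι → ℝ))) (pull (liftMap (kingPr L k m M) ι))
        (Matrix.mulVecLin (csavg M (L ^ m * L ^ k) (cvT₀ e (fun μ p => NormedSpace.exp ((((((L ^ m * L ^ k : ℕ) : ℝ)))⁻¹) • A' μ p))))ᵀ) (Matrix.mulVecLin (csavg M (L ^ k) (cvT₀ e (fun μ p => NormedSpace.exp ((((((L ^ k : ℕ) : ℝ)))⁻¹) • gavgM (Matrix mm mm ℂ) (Fin (d + 1)) (kingPrV L k m M) A' μ p))))ᵀ))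
      (fun y y' => if y = y' then ((((((L ^ k : ℕ) : ℝ))) ^ (d + 1)))⁻¹ * (Fintype.card ι * (@basisConst ι _ (Matrix mm mm ℂ) Matrix.frobeniusNormedAddCommGroup Matrix.frobeniusNormedSpace e * (2 * Real.sqrt (Fintype.card mm)) * (Real.sqrt (Fintype.card mm) * (3 ^ (d + 1) * ((d + 1) * (36 * (((L ^ m * L ^ k : ℕ) : ℝ)) * (((((L ^ m * L ^ k : ℕ) : ℝ)))⁻¹ * ((2 * ((d + 1) * (L ^ m - 1)) : ℕ) * (r * ((((L ^ m * L ^ k : ℕ) : ℝ)))⁻¹))) + 9 * (((L ^ m : ℕ) : ℝ) * (((((L ^ m * L ^ k : ℕ) : ℝ)))⁻¹ * r)))))))) else 0) :=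
  hasMaj_idef_nu_csavg_transpose M L k m (cvT₀ e (fun μ p => NormedSpace.exp ((((((L ^ k : ℕ) : ℝ)))⁻¹) • gavgM (Matrix mm mm ℂ) (Fin (d + 1)) (kingPrV L k m M) A' μ p))) (cvT₀ e (fun μ p => NormedSpace.exp ((((((L ^ m * L ^ k : ℕ) : ℝ)))⁻¹) • A' μ p))) (by have := @basisConst_nonneg ι _ (Matrix mm mm ℂ) Matrix.frobeniusNormedAddCommGroup Matrix.frobeniusNormedSpace e; positivity)
    (fun x' i => stairFit_cols_le M k m e hAs hr0 hr1 hA hstep x' i)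

end StairFit

end Summit.QuantumFields.YangMills.BalabanUVNodes.N15.Gluing

end
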